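import Mathlib.Analysis.Fourier.Convolution
import Mathlib.MeasureTheory.Function.LpSeminorm.SMul
import Literature.Analysis.FunctionSpaces.MinkowskiIntegral
import Literature.Analysis.Fourier.LpMultiplierTranslation
import HarnessLib

/-!
# Schwartz symbols are `Lᵖ` multipliers (Young's inequality)

[BrennerThomeeWahlbin1975, Ch. 1 §2 and Ch. 5, proof of Lemma 1.1]: "`χv` and `w` both belong to
`C₀^∞(ℝᵈ)` and hence to `M_p`" — a smooth compactly supported (more generally Schwartz) symbol
`m` has an integrable kernel `𝓕⁻¹m`, so `m(D)u = 𝓕⁻¹m ∗ u` and Young's inequality gives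
`‖m(D)u‖_p ≤ ‖𝓕⁻¹m‖₁‖u‖_p` for `1 ≤ p ≤ ∞` [loc. cit., Ch. 1 Thm 2.3 and its converse:
`M_∞ = M_1 =` Fourier transforms of bounded measures, `M_1 ⊂ M_p` by Thm 2.4]. Also the input
`χ/g ∈ C₀^∞ ⊆ M_p` of [loc. cit., Ch. 1 Cor 5.1 (5.1)].

PROVED here for `1 ≤ p < ∞` and scalar Schwartz symbols acting on vector-valued functions
(`m • 1`): `eLpNorm_convolution_smul_le` (Young `L¹ × Lᵖ → Lᵖ` for a complex scalar kernel,
from Minkowski's integral inequality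
`Literature.Analysis.FunctionSpaces.eLpNorm_integral_le_lintegral_eLpNorm`),
`multiplierOp_smul_one_eq_convolution` (`(m•1)(D)f = 𝓕⁻¹m ∗ f`, from Mathlib's
`SchwartzMap.convolution`), `isLpMultiplierWith_smul_one_schwartz` (constant `‖𝓕⁻¹m‖₁`).

## References

* [BrennerThomeeWahlbin1975] P. Brenner, V. Thomée, L. B. Wahlbin, LNM 434 (1975), Ch. 1
  Thms 2.3–2.4 pp. 9–11; Ch. 5 §1, proof of Lemma 1.1 (1.5).
-/

noncomputable section

open MeasureTheory FourierTransform Convolution ContinuousLinearMap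
open scoped SchwartzMap ENNReal NNReal

namespace Literature.Analysis.Fourier

variable {V : Type*} [NormedAddCommGroup V] [InnerProductSpace ℝ V] [FiniteDimensional ℝ V]
  [MeasurableSpace V] [BorelSpace V] {F : Type*} [NormedAddCommGroup F] [NormedSpace ℂ F]
  {ι : Type*} [Fintype ι]

/-! ### Young's inequality for a complex scalar kernel -/

/-- **Young's inequality `L¹ × Lᵖ → Lᵖ`** for the convolution `k ∗ f (x) = ∫ k(t) f(x - t) dt`
of a complex scalar kernel with a vector-valued function, `1 ≤ p < ∞`:
`‖k ∗ f‖_p ≤ ‖k‖₁ ‖f‖_p` (Minkowski's integral inequality and translation invariance).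
[folklore] -/
theorem eLpNorm_convolution_smul_le {k : V → ℂ} (hk : AEStronglyMeasurable k volume)
    {f : V → F} (hf : AEStronglyMeasurable f volume) {p : ℝ≥0∞} (hp1 : 1 ≤ p) (hp : p ≠ ⊤) :
    eLpNorm (k ⋆[lsmul ℂ ℂ] f) p volume ≤ (∫⁻ t, ‖k t‖ₑ) * eLpNorm f p volume := by
  have hF : AEStronglyMeasurable (Function.uncurry fun x t : V => k t • f (x - t))
      ((volume : Measure V).prod volume) := by
    refine AEStronglyMeasurable.smul hk.comp_snd ?_
    exact hf.comp_quasiMeasurePreserving (quasiMeasurePreserving_sub volume volume)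
  have h1 : (k ⋆[lsmul ℂ ℂ] f) = fun x => ∫ t, k t • f (x - t) := by
    funext x; rfl
  rw [h1]
  calc eLpNorm (fun x => ∫ t, k t • f (x - t)) p volume
      ≤ ∫⁻ t, eLpNorm (fun x => k t • f (x - t)) p volume :=
        FunctionSpaces.eLpNorm_integral_le_lintegral_eLpNorm hF hp1 hp
    _ = ∫⁻ t, ‖k t‖ₑ * eLpNorm f p volume := by
        refine lintegral_congr fun t => ?_
        change eLpNorm (k t • fun x => f (x - t)) p volume = _
        rw [eLpNorm_const_smul]
        congr 1
        simpa [sub_eq_add_neg] using eLpNorm_comp_add_right hf (-t) p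
    _ = (∫⁻ t, ‖k t‖ₑ) * eLpNorm f p volume := lintegral_mul_const'' _ hk.enorm

/-! ### Schwartz symbols -/

/-- **`(m•1)(D) f = 𝓕⁻¹m ∗ f`** for a Schwartz symbol `m` and a Schwartz `f` (Mathlib's
`SchwartzMap.convolution` is defined through the Fourier transform).
[cite: BrennerThomeeWahlbin1975, Ch. 1 Thm 2.3 (2.5)] -/
theorem multiplierOp_smul_one_eq_convolution [DecidableEq ι] (m : 𝓢(V, ℂ)) (f : 𝓢(V, ι → ℂ)) :
    multiplierOp (fun ξ => m ξ • (1 : Matrix ι ι ℂ)) ⇑f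
      = (⇑(𝓕⁻ m : 𝓢(V, ℂ)) ⋆[lsmul ℂ ℂ] ⇑f) := by
  funext x
  rw [← SchwartzMap.convolution_apply (lsmul ℂ ℂ) (𝓕⁻ m : 𝓢(V, ℂ)) f x, multiplierOp_smul_one
    m.hasTemperateGrowth]
  -- both sides are `𝓕⁻` of the same Schwartz function
  change (SchwartzMap.fourierMultiplierCLM (ι → ℂ) (⇑m) f) x
    = (𝓕⁻ (SchwartzMap.pairing (lsmul ℂ ℂ) (𝓕 (𝓕⁻ m : 𝓢(V, ℂ))) (𝓕 f))) x
  rw [SchwartzMap.fourierMultiplierCLM_apply, FourierTransform.fourier_fourierInv_eq]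
  congr 2
  ext ξ i
  rw [SchwartzMap.smulLeftCLM_apply_apply m.hasTemperateGrowth, SchwartzMap.pairing_apply_apply,
    lsmul_apply]

/-- **Schwartz symbols are `Lᵖ` multipliers**, `1 ≤ p < ∞`: `IsLpMultiplierWith p ‖𝓕⁻¹m‖₁ (m•1)`.
[cite: BrennerThomeeWahlbin1975, Ch. 1 Thms 2.3–2.4] -/
theorem isLpMultiplierWith_smul_one_schwartz [DecidableEq ι] (m : 𝓢(V, ℂ)) {p : ℝ≥0∞}
    (hp1 : 1 ≤ p) (hp : p ≠ ⊤) :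
    IsLpMultiplierWith p (∫⁻ t, ‖(𝓕⁻ m : 𝓢(V, ℂ)) t‖ₑ).toNNReal
      (fun ξ => m ξ • (1 : Matrix ι ι ℂ)) := by
  have hfin : (∫⁻ t, ‖(𝓕⁻ m : 𝓢(V, ℂ)) t‖ₑ) ≠ ⊤ :=
    (𝓕⁻ m : 𝓢(V, ℂ)).integrable.hasFiniteIntegral.ne
  refine ⟨fun f => ?_, fun f => ?_⟩
  · have : (fun ξ => (m ξ • (1 : Matrix ι ι ℂ)).mulVec (𝓕 (⇑f) ξ))
        = ⇑(SchwartzMap.smulLeftCLM (ι → ℂ) (⇑m) (𝓕 f)) := by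
      funext ξ
      rw [Matrix.smul_mulVec, Matrix.one_mulVec,
        SchwartzMap.smulLeftCLM_apply_apply m.hasTemperateGrowth, SchwartzMap.fourier_coe]
    rw [this]
    exact (SchwartzMap.smulLeftCLM (ι → ℂ) (⇑m) (𝓕 f)).integrable
  · rw [multiplierOp_smul_one_eq_convolution, ENNReal.coe_toNNReal hfin]
    exact eLpNorm_convolution_smul_le (𝓕⁻ m : 𝓢(V, ℂ)).continuous.aestronglyMeasurable
      f.continuous.aestronglyMeasurable hp1 hp

/-- Schwartz symbols are in `M_p`, `1 ≤ p < ∞`. [cite: BrennerThomeeWahlbin1975, Ch. 1 Thms 2.3–2.4] -/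
theorem isLpMultiplier_smul_one_schwartz [DecidableEq ι] (m : 𝓢(V, ℂ)) {p : ℝ≥0∞}
    (hp1 : 1 ≤ p) (hp : p ≠ ⊤) : IsLpMultiplier p (fun ξ => m ξ • (1 : Matrix ι ι ℂ)) :=
  (isLpMultiplierWith_smul_one_schwartz m hp1 hp).isLpMultiplier

end Literature.Analysis.Fourier

end
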